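/-
Copyright (c) 2026. All rights reserved.
Released under Apache 2.0 license as described in the file LICENSE.
-/
import Literature.MathematicalPhysics.QuantumFieldTheory.Balaban1983to89.B4StripSumsHolder

/-!
# B4 (2.44)–(2.48): the typed kernel of (2.48) SOLVES the basic equation (2.44) — `K = G_jQ_j^*` on the infinite fine lattice

Source: T. Bałaban, *Regularity and decay of lattice Green's functions*, Commun. Math. Phys. **89** (1983) 571–597
(bib key `Balaban1983RegularityDecay`), p. 572 [PDF 2] (1.3)–(1.6) and p. 584–585 [PDF 14–15] (2.43)–(2.48).

## The printed text (verbatim, p. 584–585)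

«Now we will construct an explicit representation for G_j. Let us introduce a Fourier transform on ξZ^d by the formulas
(2.43) f̃(p) = Σ_x ξ^d e^{−ip·x} f(x), f(x) = (2π)^{−d} ∫_{|p|≤π/ξ} e^{ix·p} f̃(p).
We apply it to the basic equation
(2.44) (−Δ^ξ + m_j² + a_jQ_j^*Q_j)φ₀ = f.
Defining the propagator G_j, φ₀ = G_jf, we get
(2.45) Δ^ξ(p)φ̃₀(p) + a_j u_j(p) Σ_{l′} \overline{u_j(p′+l′)} φ̃₀(p′+l′) = f̃(p), u_j(p) = Π_μ (e^{−ip_μ} − 1)/((e^{−iξp_μ} − 1)/ξ),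
Δ^ξ(p) = Σ_μ |(e^{−iξp_μ} − 1)/ξ|² + m_j², p′ ∈ [−π,π[^d, l′ = (l′₁,…,l′_d), l′_μ = 2πm′_μ, m′_μ is an integer […].
Solving this equation we obtain the following formula: (2.46) […].» (p. 584) and, p. 585: «To calculate G_jQ_j^*, we take
f = Q_j^*g in this formula, g is a function on the unit lattice, f̃(p) = u_j(p)g̃(p′), g̃(p′) = Σ_y e^{−ip′·y}g(y), and we get
(2.47) (G_jQ_j^*g)~(p′+l) = u_j(p′+l)/Δ^ξ(p′+l) · [a_jΣ_{l′}|u_j(p′+l′)|²/Δ^ξ(p′+l′) + 1]^{−1} g̃(p′).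
From this we obtain finally the following formula for (G_jQ_j^*)(x,y),
(2.48) (G_jQ_j^*)(x,y) = (2π)^{−d}∫_{|p′|≤π}dp′ Σ_l e^{i(p′+l)·(x−y)} [a_jΣ_{l′}|u_j(p′+l′)|²/Δ^ξ(p′+l′) + 1]^{−1} u_j(p′+l)/Δ^ξ(p′+l).»
and p. 572: «(1.3) ⟨φ, (−Δ^{η,N}_{A,Ω})φ⟩ = Σ_{b⊂Ω} η^d |η^{−1}(U(A_b)φ(b₊) − φ(b₋))|² […] (1.4) (Q_k(A)φ)(y) = Σ_{x∈B^k(y)} η^d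
U(A(Γ^{(k)}_{y,x})) φ(x), y ∈ Z^d […] (1.5) P_k(A) = Q_k^*(A) Q_k(A) […] (1.6) G_k(Ω, A) = (−Δ^{η,N}_{A,Ω} + m² + aP_k(A))^{−1},
where m² ≥ 0 and a is a positive constant close to 1.»

## What this file certifies (kernel-checked; no hypothesis beyond `n ≥ 1`, `a > 0`, `m² ≥ 0`)

The sibling modules `B4StripSums` / `B4StripSumsDeriv` / `B4StripSumsHolder` / `B4Torus248Decay` type the right-hand side of
(2.48) as the lattice kernel `latticeKernel (B4StripSums.G n a m² τ)` of an explicit Fourier multiplier and prove Lemma 2.4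
(2.35)–(2.36) FOR THAT OBJECT; that this object is the operator kernel `G_jQ_j^*` of (2.44) — i.e. that the displayed
formula (2.46)–(2.48) really solves the basic equation — was so far a docstring dictionary. Here it is a theorem:

* `green244` — **(2.44) for the kernel (2.48)**: with `K n a m² z y := latticeKernel (G n a m² (z mod n)) (⌊z/n⌋ − y)`
  (`z ∈ ℤ^d` a fine point in `ξ`-units, `y ∈ ℤ^d` a unit-lattice point) and `D = −Δ^ξ + m² + aQ^*Q` (`opD`),
  `D_z K(z, y) = 1_{B(y)}(z) = (Q_j^*δ_y)(z)` for all `z, y`, every `n ≥ 1`, `a > 0`, `m² ≥ 0`: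
  `φ₀ = K(·, y) = (G_jQ_j^*)(ξ·, y)` solves (2.44) with `f = Q_j^*δ_y`
  (kernel convention `(G_jQ_j^*g)(ξz) = Σ_y K(z,y) g(y)`; `D G_j = ξ^{−d}δ` on `ℓ²(ξℤ^d, ξ^d)` gives `D (G_jQ_j^*)(·,y) = Q_j^*δ_y`).
* `opD_Gfull` — THE SYMBOL IDENTITY behind it ((2.45) ⇒ (2.47), checked): `D_z Gfull(z; p′) = e^{ip′·⌊z/n⌋}`, `p′ ∈ [−π,π]^d`,
  where `Gfull(z; p′) = Σ_k e^{i(p′+2πk)·z/n} V_k(p′) R_k(p′)/E(p′)` is the `l`-sum of (2.48) with its full phase (`K_eq`: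
  `K(z,y) = (2π)^{−d}∫ Gfull(z;p′) e^{−ip′·y} dp′`, literally (2.48));
  ingredients: the plane wave `e^{i(p′+l)·z/n}` is an eigenfunction of `−Δ^ξ + m²` with eigenvalue `Δ^ξ(p′+l)` (paper's
  `Δ^ξ` includes `m_j²`) — `lap_PhZ`; `R_k Δ^ξ(p′+2πk) = Δ^ξ(p′)` — `R_mul_DeltaXi_shift`; **`Q_jQ_j^* = 1`**:
  `Σ_l e^{i(p′+l)·z/n} u_j(p′+l) = e^{ip′·⌊z/n⌋}` — `sum_PhZ_V` (root-of-unity orthogonality `sum_ef_mul_v`); **`Q_j` of the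
  plane wave times `u`** = `e^{ip′·x⁰}|u_j(p′+l)|²` on the real zone — `blockAvg_PhZ_V` (the exact conjugate-pair identity
  `v̄·v = uFactor`, `vb_mul_v_eq_uFactor`, incl. the removable point `p′_μ = l_μ = 0`); and `Δ^ξ(p′) + aΣ_l|u_j(p′+l)|²R_l = E`
  — `E_eq_sum_R` (the definition of the regrouped denominator `B4Strip.E`), `E ≠ 0` on the zone for `a > 0` (`B4Strip.E_re_ge`).
* the lattice-kernel calculus used: a phase `e^{ip′·s}` translates the kernel (`latticeKernel_phase_mul`), zone-holomorphic
  multipliers superpose (`latticeKernel_sum_mul`, `integrableOn_of_differentiableAt`, `differentiableAt_Gfull`), the finite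
  stencil `D` commutes with multiplier ↦ kernel (`opD_latticeKernel`), and `(2π)^{−d}∫_{[−π,π]^d}e^{ip·x}dp = δ_{x,0}`
  (`latticeKernel_one`, Fubini `MeasureTheory.integral_fintype_prod_eq_prod` + `integral_exp_mul_complex`).
* `K_decay` — (2.35) for the same `K` (= `B4StripSums.kernel248_decay` through the definition), so that the solution of (2.44)
  and the exponentially decaying kernel are provably one object.

## Dictionary (paper ↦ Lean), scope, divergences

`ξ = L^{−j} = 1/n` (any `n ≥ 1`; `L`, `j` enter only through `n`); fine point `x = ξz`, `z : Fin d → ℤ`; block label `y`-lattice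
point `x⁰ = ⌊z/n⌋ = coarse n z`, offset `τ = z mod n = offset n z` (`finePt_coarse_offset`); `l = 2πk`, `k : Fin d → Fin n`
(representatives `0 ≤ k_μ < n` instead of the printed symmetric range — all fibre quantities are `2π`-periodic in `l_μ`, cf.
`B4StripSums.shift_decomp`); `u_j(p′+l) = V n k p′ = Π_ν v_n(k_ν; p′_ν)` (`B4StripSums.v`, `v_eq_quotient`); its conjugate
`\overline{u_j}` on the real zone = `Vb`/`vb`; `e^{i(p′+l)·x} = PhZ n k z p′` (`B4StripSumsHolder.efZ/PhZ`); `|u_j(p′+l)|² = U n k`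
(`B4Strip.uFactor/U`); `Δ^ξ(p′+l)` (with `m_j²`) `= DeltaXi n m² (shift n k p′)`; the bracket and `1/Δ^ξ(p′+l)` in the REGROUPED
form `R_k/E` of `B4StripSums` (`R_div_E_eq_printed`; the printed factorisation has poles off the real zone, `B4Strip.printed_factor_has_poles`);
`−Δ^ξ = negLap n` ((1.3) with `A = 0` on all of `ξℤ^d`: `ξ^{−2}Σ_μ[2φ(z) − φ(z+e_μ) − φ(z−e_μ)]`); `Q^*Q = blockAvg n` ((1.4)–(1.5)
with `A = 0`: `ξ^dΣ_{z′∈B(z)}`); `a_j ↦ a` (any real `a > 0`; the printed `a_j = a(1−L^{−2})(1−L^{−2j})^{−1}` of (1.7)/(2.44) is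
one such value); `D = opD n a m²`; `(G_jQ_j^*)(x, y) = K n a m² z y`.
SCOPE / DIVERGENCE: (i) the infinite lattice `ξℤ^d` with free boundary conditions and `A = 0` — exactly the setting of
(2.43)–(2.48) («the propagator G_j with free boundary conditions on ξZ^d»); the passage to `G_j(□)` by reflections (2.42) and
to the torus is NOT in this file (see `B4Torus248Decay`, and the reflection node of the pv17 lineage); (ii) we certify that
the displayed kernel SATISFIES (2.44) (the existence half of «φ₀ = G_jf»); that it is THE inverse — uniqueness of `ℓ²`
solutions, i.e. injectivity of `D ≥ m² + aQ^*Q` on `ℓ²` — is not typed here (remark: for `a > 0` it follows from `−Δ^ξ ≥ 0`,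
`Q^*Q ≥ 0` and `ker(−Δ^ξ) ∩ ker Q = 0` on `ℓ²`); (iii) only `f = Q_j^*δ_y`, i.e. the operator `G_jQ_j^*` of (2.47)–(2.48) and
Lemma 2.4, not `G_j` itself ((2.46) for general `f` is not needed for (2.35)–(2.36) and is not typed).

Tags: 16 `[cite: Balaban1983RegularityDecay, …]` (the dictionary objects `V`, `Gfull`, `negLap`, `blockAvg`, `opD`, `K` and the
ten statements that ARE printed steps: `vb_mul_v_of_w_ne_one`, `vb_mul_v_eq_uFactor`, `Gfull_finePt`, `lap_PhZ`, `sum_PhZ_V`,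
`blockAvg_PhZ_V`, `opD_Gfull`, `K_eq`, `green244`, `K_decay`), 45 `[folklore]` (trigonometric sums, stencil bookkeeping,
lattice-kernel calculus). No `sorry`, no new axioms; imports only `B4StripSumsHolder` (for `efZ`/`PhZ`; transitively
`B4StripSums`, `B4Strip`, `B4ContourShift`).

REVISION LOG. v1 = p180019 (commit 774a21ab7aa6).  v1.1 (this text; DOCSTRING-ONLY, no declaration, statement or proof
touched): referee objection G-ref6-1 (cross-read REFEREE6.md E47, violation V1, quotation fidelity) — v1's header quoted
p. 585 as «… (2.46) […]. Especially we have (2.47) …, for f = Q_j^*g, f̃(p) = u_j(p)g̃(p′), g̃(p′) = …» and the `green244`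
docstring as «… Solving this equation we obtain (2.46) … Especially we have (2.47)»; the words «Especially we have» are not
printed and the clause «for f = Q_j^*g» was moved behind the display and reworded. Both places now quote p. 585 [PDF 15] as
printed (re-read on the page image): «To calculate G_jQ_j^*, we take f = Q_j^*g in this formula, g is a function on the unit
lattice, f̃(p) = u_j(p)g̃(p′), g̃(p′) = Σ_y e^{−ip′·y}g(y), and we get (2.47)» and «From this we obtain finally the following
formula for (G_jQ_j^*)(x,y), (2.48)». Elisions inside «…» are marked […].
-/

namespace Literature.MathematicalPhysics.QuantumFieldTheory.Balaban1983to89.B4Green244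

open Complex Finset MeasureTheory
open Literature.MathematicalPhysics.QuantumFieldTheory.Balaban1983to89.B4Strip
open Literature.MathematicalPhysics.QuantumFieldTheory.Balaban1983to89.B4StripCauchy
open Literature.MathematicalPhysics.QuantumFieldTheory.Balaban1983to89.B5Strip145Analytic
open Literature.MathematicalPhysics.QuantumFieldTheory.Balaban1983to89.B5Strip145Decay
open Literature.MathematicalPhysics.QuantumFieldTheory.Balaban1983to89.B4ContourShift
open Literature.MathematicalPhysics.QuantumFieldTheory.Balaban1983to89.B4StripSums
open Literature.MathematicalPhysics.QuantumFieldTheory.Balaban1983to89.B4StripSumsHolder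
open scoped Real

noncomputable section

variable {d : ℕ}

/-! ### §1 One coordinate: `Q_jQ_j^* = 1` and `u·ū = |u|²` on the fibre `p′ + 2πj`, `j = 0,…,n-1` -/

/-- the phase is an inverse power of `w`: `e^{i(z+2πj)t/n} = (w_n(j;z)⁻¹)^t`. [folklore] -/
theorem ef_eq_inv_w_pow (n j t : ℕ) (z : ℂ) : ef n j t z = (w n j z)⁻¹ ^ t := by
  unfold ef w
  rw [← Complex.exp_neg, neg_neg, ← Complex.exp_nat_mul]
  congr 1
  ring

/-- `w ≠ 0`. [folklore] -/
theorem w_ne_zero (n j : ℕ) (z : ℂ) : w n j z ≠ 0 := Complex.exp_ne_zero _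

/-- `e^{i(z+2πj)t/n} · w_n(j;z)^s = e^{iz(t-s)/n} · q^{j}` with `q = e^{2πi(t-s)/n}`. [folklore] -/
theorem ef_mul_w_pow (n j t s : ℕ) (hn : n ≠ 0) (z : ℂ) :
    ef n j t z * w n j z ^ s
      = cexp (I * z * ((t : ℂ) - s) / n) * cexp (2 * π * I * ((t : ℂ) - s) / n) ^ j := by
  unfold ef w
  rw [← Complex.exp_nat_mul, ← Complex.exp_nat_mul, ← Complex.exp_add, ← Complex.exp_add]
  congr 1
  have hn' : (n : ℂ) ≠ 0 := Nat.cast_ne_zero.mpr hn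
  field_simp
  ring

/-- the root-of-unity sum: `Σ_{j<n} q^j = n` if `q = e^{2πi m/n}` with `m = 0`, and `= 0` for `0 < |m| < n`
(here `m = t - s` with `t, s < n`). [folklore] -/
theorem sum_rootOfUnity_pow (n t s : ℕ) (hn : n ≠ 0) (ht : t < n) (hs : s < n) :
    ∑ j ∈ Finset.range n, cexp (2 * π * I * ((t : ℂ) - s) / n) ^ j = if s = t then (n : ℂ) else 0 := by
  set q : ℂ := cexp (2 * π * I * ((t : ℂ) - s) / n) with hq
  have hn' : (n : ℂ) ≠ 0 := Nat.cast_ne_zero.mpr hn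
  split_ifs with hst
  · subst hst
    have h1 : q = 1 := by rw [hq, sub_self, mul_zero, zero_div, Complex.exp_zero]
    simp [h1]
  · have hq1 : q ≠ 1 := by
      intro h1
      rw [hq, Complex.exp_eq_one_iff] at h1
      obtain ⟨N, hN⟩ := h1
      have h2 : ((t : ℂ) - s) = N * n := by
        have hπ : (π : ℂ) ≠ 0 := by exact_mod_cast Real.pi_ne_zero
        field_simp at hN
        linear_combination hN
      have h4 : ((t : ℤ) - s : ℤ) = N * n := by exact_mod_cast h2
      rcases lt_trichotomy N 0 with hN0 | hN0 | hN0
      · have : (N : ℤ) * n ≤ -n := by nlinarith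
        omega
      · subst hN0; simp at h4; omega
      · have : (n : ℤ) ≤ N * n := by nlinarith
        omega
    have hqn : q ^ n = 1 := by
      rw [hq, ← Complex.exp_nat_mul]
      rw [show (n : ℂ) * (2 * π * I * ((t : ℂ) - s) / n) = ((t : ℤ) - s : ℤ) * (2 * π * I) by
        push_cast; field_simp]
      exact Complex.exp_int_mul_two_pi_mul_I _
    rw [geom_sum_eq hq1, hqn, sub_self, zero_div]

/-- **`Q_jQ_j^* = 1` on the fibre**: `Σ_{j<n} e^{i(z+2πj)t/n} v_n(j; z) = 1` for every `t ∈ {0,…,n-1}` and every complex `z`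
(the `l`-sum of `e^{i(p′+l)·ξτ} u_j(p′+l)` over the fibre is `1`). [folklore] -/
theorem sum_ef_mul_v (n t : ℕ) (hn : n ≠ 0) (ht : t < n) (z : ℂ) :
    ∑ j ∈ Finset.range n, ef n j t z * v n j z = 1 := by
  have hn' : (n : ℂ) ≠ 0 := Nat.cast_ne_zero.mpr hn
  unfold v
  have h : ∀ j ∈ Finset.range n, ef n j t z * ((n : ℂ)⁻¹ * ∑ s ∈ Finset.range n, w n j z ^ s)
      = (n : ℂ)⁻¹ * ∑ s ∈ Finset.range n,
          cexp (I * z * ((t : ℂ) - s) / n) * cexp (2 * π * I * ((t : ℂ) - s) / n) ^ j := by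
    intro j _
    rw [Finset.mul_sum, Finset.mul_sum, Finset.mul_sum]
    apply Finset.sum_congr rfl
    intro s _
    rw [← ef_mul_w_pow n j t s hn z]
    ring
  rw [Finset.sum_congr rfl h, ← Finset.mul_sum, Finset.sum_comm]
  simp_rw [← Finset.mul_sum]
  have h' : ∀ s ∈ Finset.range n,
      cexp (I * z * ((t : ℂ) - s) / n) * ∑ j ∈ Finset.range n, cexp (2 * π * I * ((t : ℂ) - s) / n) ^ j
        = if s = t then (n : ℂ) else 0 := by
    intro s hs
    rw [sum_rootOfUnity_pow n t s hn ht (Finset.mem_range.mp hs)]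
    split_ifs with hst
    · subst hst; rw [sub_self, mul_zero, zero_div, Complex.exp_zero, one_mul]
    · rw [mul_zero]
  rw [Finset.sum_congr rfl h', Finset.sum_ite_eq' (Finset.range n) t, if_pos (Finset.mem_range.mpr ht),
    inv_mul_cancel₀ hn']

/-- the CONJUGATE factor `v̄_n(j; z) = (1/n) Σ_{s<n} e^{i(z+2πj)s/n}` — the continuation of `ξ(e^{ip_μ} − 1)/(e^{iξ(p+l)_μ} − 1)`,
the complex conjugate of `u`'s factor for real momenta; it is what the block average `Q_j` produces. [folklore] -/
def vb (n j : ℕ) (z : ℂ) : ℂ := (n : ℂ)⁻¹ * ∑ s ∈ Finset.range n, ef n j s z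

/-- `S₁(z) = 2 − w^{-n} − w^{n}` with `w = w_n(j; z)` (`w^n = e^{-iz}`). [folklore] -/
theorem S1_eq_w (n j : ℕ) (hn : n ≠ 0) (z : ℂ) : S1 z = 2 - (w n j z ^ n)⁻¹ - w n j z ^ n := by
  rw [w_pow n j hn z, ← Complex.exp_neg, neg_neg]
  unfold S1
  rw [Complex.cos, show -(I * z) = -z * I by ring, show I * z = z * I by ring]
  ring

/-- `S₁((z+2πj)/n) = 2 − w⁻¹ − w`. [folklore] -/
theorem S1_div_eq_w (n j : ℕ) (z : ℂ) : S1 ((z + 2 * π * j) / n) = 2 - (w n j z)⁻¹ - w n j z := by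
  unfold S1 w
  rw [← Complex.exp_neg, neg_neg, Complex.cos,
    show -(I * (z + 2 * π * j) / n) = -((z + 2 * π * j) / n) * I by ring,
    show I * (z + 2 * π * j) / n = (z + 2 * π * j) / n * I by ring]
  ring

/-- `v̄·v = S₁(z)/S_ξ(z + 2πj)` off the zeros of the denominator (`w ≠ 1`): the exact form of `|u_j(p′+l)|² =
Π_μ |e^{-ip′_μ} − 1|²/|(e^{-iξ(p′+l)_μ} − 1)/ξ|²` factorwise. [cite: Balaban1983RegularityDecay, (2.45)–(2.46) p.584] -/
theorem vb_mul_v_of_w_ne_one (n j : ℕ) (hn : n ≠ 0) {z : ℂ} (hw : w n j z ≠ 1) :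
    vb n j z * v n j z = S1 z / Sxi n (z + 2 * π * j) := by
  have hn' : (n : ℂ) ≠ 0 := Nat.cast_ne_zero.mpr hn
  have hw0 : w n j z ≠ 0 := w_ne_zero n j z
  have hwi : (w n j z)⁻¹ ≠ 1 := by rwa [Ne, inv_eq_one]
  have hvb : vb n j z = (n : ℂ)⁻¹ * (((w n j z ^ n)⁻¹ - 1) / ((w n j z)⁻¹ - 1)) := by
    unfold vb
    simp_rw [ef_eq_inv_w_pow]
    rw [geom_sum_eq hwi, inv_pow]
  have hv : v n j z = (n : ℂ)⁻¹ * ((w n j z ^ n - 1) / (w n j z - 1)) := by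
    unfold v
    rw [geom_sum_eq hw]
  rw [hvb, hv, Sxi_eq_sq_mul_S1, S1_div_eq_w, S1_eq_w n j hn z]
  have hwn : w n j z ^ n ≠ 0 := pow_ne_zero _ hw0
  have h1 : (w n j z)⁻¹ - 1 ≠ 0 := sub_ne_zero.mpr hwi
  have h2 : w n j z - 1 ≠ 0 := sub_ne_zero.mpr hw
  have key : (2 : ℂ) - (w n j z)⁻¹ - w n j z = ((w n j z)⁻¹ - 1) * (w n j z - 1) := by
    field_simp
    ring
  have key2 : (2 : ℂ) - (w n j z ^ n)⁻¹ - w n j z ^ n = ((w n j z ^ n)⁻¹ - 1) * (w n j z ^ n - 1) := by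
    field_simp
    ring
  rw [key, key2]
  field_simp

/-- on the real Brillouin zone the only zero of the fibre denominators is `p′_μ = 0`, `l_μ = 0`:
for `|x| ≤ π`, `j < n`, `(j, x) ≠ (0, 0)` one has `S_ξ(x + 2πj) ≠ 0`. [folklore] -/
theorem Sxi_shift_ne_zero_real (n j : ℕ) (hn : 1 ≤ n) (hj : j < n) (x : ℝ) (hx : |x| ≤ π) (h0 : ¬(j = 0 ∧ x = 0)) :
    Sxi n ((x : ℂ) + 2 * π * j) ≠ 0 := by
  have hcast : ((x : ℂ) + 2 * π * j) = ((x + 2 * π * j : ℝ) : ℂ) := by push_cast; ring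
  rw [hcast, Sxi_ofReal, Complex.ofReal_ne_zero, Sxir_eq]
  have hnr : (1 : ℝ) ≤ n := by exact_mod_cast hn
  have hjr : (j : ℝ) ≤ n - 1 := by
    have : (j : ℝ) + 1 ≤ n := by exact_mod_cast hj
    linarith
  set y : ℝ := x + 2 * π * j with hy
  have hy0 : y ≠ 0 := by
    intro hy0
    rcases Nat.eq_zero_or_pos j with hj0 | hj0
    · subst hj0
      apply h0
      refine ⟨rfl, ?_⟩
      simpa [hy] using hy0
    · have : (1 : ℝ) ≤ j := by exact_mod_cast hj0
      have hxl : -π ≤ x := (abs_le.mp hx).1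
      have : 0 < y := by rw [hy]; nlinarith [Real.pi_pos]
      linarith
  have hlo : -π < y / (2 * n) := by
    rw [lt_div_iff₀ (by positivity)]
    have hxl : -π ≤ x := (abs_le.mp hx).1
    have : (0 : ℝ) ≤ 2 * π * j := by positivity
    nlinarith [Real.pi_pos]
  have hhi : y / (2 * n) < π := by
    rw [div_lt_iff₀ (by positivity)]
    have hxu : x ≤ π := (abs_le.mp hx).2
    have : y ≤ π + 2 * π * (n - 1) := by rw [hy]; nlinarith [Real.pi_pos]
    nlinarith [Real.pi_pos]
  have hsin : Real.sin (y / (2 * n)) ≠ 0 := by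
    intro hs
    have := (Real.sin_eq_zero_iff_of_lt_of_lt hlo hhi).mp hs
    apply hy0
    have h2n : (2 * (n : ℝ)) ≠ 0 := by positivity
    field_simp at this
    linarith [this]
  positivity

/-- **`u·ū = |u|²` on the real zone, exactly**: for `|x| ≤ π` and `j < n`,
`v̄_n(j; x) · v_n(j; x) = uFactor n j x` (`= S₁(x)/S_ξ(x+2πj)`, with the removable value `1` at `x = 0`, `j = 0`).
[cite: Balaban1983RegularityDecay, (2.45)–(2.46) p.584] -/
theorem vb_mul_v_eq_uFactor (n j : ℕ) (hn : 1 ≤ n) (hj : j < n) (x : ℝ) (hx : |x| ≤ π) :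
    vb n j x * v n j x = uFactor n j x := by
  have hn0 : n ≠ 0 := by omega
  by_cases h0 : j = 0 ∧ x = 0
  · obtain ⟨rfl, rfl⟩ := h0
    have hw : w n 0 ((0 : ℝ) : ℂ) = 1 := by unfold w; simp
    have hv : v n 0 ((0 : ℝ) : ℂ) = 1 := by
      unfold v
      simp_rw [hw, one_pow]
      rw [Finset.sum_const, Finset.card_range, nsmul_eq_mul, mul_one,
        inv_mul_cancel₀ (Nat.cast_ne_zero.mpr hn0)]
    have hvb : vb n 0 ((0 : ℝ) : ℂ) = 1 := by
      unfold vb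
      simp_rw [ef_eq_inv_w_pow, hw, inv_one, one_pow]
      rw [Finset.sum_const, Finset.card_range, nsmul_eq_mul, mul_one,
        inv_mul_cancel₀ (Nat.cast_ne_zero.mpr hn0)]
    rw [hv, hvb, Complex.ofReal_zero]
    unfold uFactor
    simp
  · have hS := Sxi_shift_ne_zero_real n j hn hj x hx h0
    rw [vb_mul_v_of_w_ne_one n j hn0 (w_ne_one n j hS)]
    unfold uFactor
    by_cases hj0 : j = 0
    · subst hj0
      have hx0 : (x : ℂ) ≠ 0 := by
        intro hx0; exact h0 ⟨rfl, by exact_mod_cast hx0⟩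
      simp [hx0]
    · simp [hj0]

/-- `2 − e^{iθ} − e^{−iθ} = S₁(θ)`. [folklore] -/
theorem two_sub_exp (θ : ℂ) : 2 - cexp (I * θ) - cexp (-(I * θ)) = S1 θ := by
  unfold S1
  rw [Complex.cos, show -(I * θ) = -θ * I by ring, show I * θ = θ * I by ring]
  ring

/-! ### §2 Fine-lattice bookkeeping: block label `⌊z/n⌋`, offset `z mod n`, the multiplier at full offset -/

/-- the block label `x⁰ = ⌊z/n⌋ ∈ ℤ^d` of a fine point `z ∈ ℤ^d` (`ξ`-units; `x = ξ z ∈ B(x⁰)`, `n = L^j = ξ⁻¹`). [folklore] -/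
def coarse (n : ℕ) (z : Fin d → ℤ) : Fin d → ℤ := fun ν => z ν / n

/-- the offset `τ = z mod n ∈ {0,…,n-1}^d` of a fine point inside its block (`x = x⁰ + ξτ`). [folklore] -/
def offset (n : ℕ) [NeZero n] (z : Fin d → ℤ) : Fin d → Fin n := fun ν =>
  ⟨(z ν % n).toNat, by
    have h0 : (0 : ℤ) ≤ z ν % n := Int.emod_nonneg _ (by exact_mod_cast NeZero.ne n)
    have h1 : z ν % n < n := Int.emod_lt_of_pos _ (by exact_mod_cast Nat.pos_of_ne_zero (NeZero.ne n))
    omega⟩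

/-- the fine point with block label `x` and offset `j`: `z = n x + j`. [folklore] -/
def finePt (n : ℕ) (x : Fin d → ℤ) (j : Fin d → Fin n) : Fin d → ℤ := fun ν => (n : ℤ) * x ν + ((j ν : ℕ) : ℤ)

/-- `z = n ⌊z/n⌋ + (z mod n)`. [folklore] -/
theorem finePt_coarse_offset (n : ℕ) [NeZero n] (z : Fin d → ℤ) : finePt n (coarse n z) (offset n z) = z := by
  funext ν
  simp only [finePt, coarse, offset]
  have h0 : (0 : ℤ) ≤ z ν % n := Int.emod_nonneg _ (by exact_mod_cast NeZero.ne n)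
  rw [Int.toNat_of_nonneg h0]
  exact Int.mul_ediv_add_emod _ _

/-- `⌊(n x + j)/n⌋ = x`. [folklore] -/
theorem coarse_finePt (n : ℕ) [NeZero n] (x : Fin d → ℤ) (j : Fin d → Fin n) : coarse n (finePt n x j) = x := by
  funext ν
  simp only [finePt, coarse]
  have hn : (0 : ℤ) < n := by exact_mod_cast Nat.pos_of_ne_zero (NeZero.ne n)
  have hj : ((j ν : ℕ) : ℤ) / n = 0 := Int.ediv_eq_zero_of_lt (by positivity) (by exact_mod_cast (j ν).isLt)
  rw [Int.mul_add_ediv_left _ _ hn.ne', hj, add_zero]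

/-- the unit vector `e_μ ∈ ℤ^d`. [folklore] -/
def e (μ : Fin d) : Fin d → ℤ := Pi.single μ 1

/-- the complex phase `P·x = Σ_μ P_μ x_μ` (complex momenta, lattice point `x ∈ ℤ^d`). [folklore] -/
def phaseC (P : Fin d → ℂ) (x : Fin d → ℤ) : ℂ := ∑ μ, P μ * (x μ : ℂ)

/-- on real momenta `phaseC` is the `phase` of `B4ContourShift`. [folklore] -/
theorem phaseC_ofRealVec (p : Fin d → ℝ) (x : Fin d → ℤ) : phaseC (ofRealVec p) x = phase p x := rfl

/-- additivity of the phase in the lattice point. [folklore] -/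
theorem phase_add (p : Fin d → ℝ) (x y : Fin d → ℤ) : phase p (x + y) = phase p x + phase p y := by
  unfold phase
  rw [← Finset.sum_add_distrib]
  apply Finset.sum_congr rfl
  intro μ _
  rw [Pi.add_apply]; push_cast; ring

/-- `V_n(k; p) = Π_ν v_n(k_ν; p_ν)`: the continuation of `u_j(p′ + l)` stripped of its phase, `l = 2πk`
(`= F` at offset `τ = 0`). [cite: Balaban1983RegularityDecay, (2.45) p.584] -/
def V (n : ℕ) (k : Fin d → Fin n) (p : Fin d → ℂ) : ℂ := ∏ ν, v n (k ν : ℕ) (p ν)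

/-- `ef` at `t = 0` is `1`. [folklore] -/
theorem ef_zero (n j : ℕ) (z : ℂ) : ef n j 0 z = 1 := by unfold ef; simp

/-- `V = F(τ = 0)`. [folklore] -/
theorem F_zero (n : ℕ) [NeZero n] (k : Fin d → Fin n) (p : Fin d → ℂ) : F n (fun _ => (0 : Fin n)) k p = V n k p := by
  unfold F V
  apply Finset.prod_congr rfl
  intro ν _
  rw [Fin.val_zero, ef_zero, one_mul]

/-- THE MULTIPLIER OF `G_jQ_j^*` READ AT THE FINE POINT `z ∈ ℤ^d` (all of `x = ξz`, not only its offset):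
`Gfull(z; p′) = Σ_k e^{i(p′+2πk)·z/n} V(k; p′) R_k(p′)/E(p′)` — the `l`-sum of (2.48) with the full phase `e^{i(p′+l)x}`;
at `z = n x⁰ + τ` it is `e^{ip′·x⁰} G(τ; p′)` (`Gfull_finePt`). [cite: Balaban1983RegularityDecay, (2.47)–(2.48) p.585] -/
def Gfull (n : ℕ) [NeZero n] (a m2 : ℝ) (z : Fin d → ℤ) (p : Fin d → ℂ) : ℂ :=
  ∑ k : Fin d → Fin n, PhZ n k z p * V n k p * R n m2 k p / E n a m2 p

/-- one coordinate of the phase at a fine point: `e^{i(ζ+2πj)(nx+t)/n} = e^{iζx} e^{i(ζ+2πj)t/n}` (`e^{2πijx} = 1`). [folklore] -/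
theorem efZ_fine (n j : ℕ) (hn : n ≠ 0) (x : ℤ) (t : ℕ) (ζ : ℂ) :
    efZ n j ((n : ℤ) * x + (t : ℕ)) ζ = cexp (I * ζ * x) * ef n j t ζ := by
  unfold efZ ef
  have hn' : (n : ℂ) ≠ 0 := Nat.cast_ne_zero.mpr hn
  rw [show I * (ζ + 2 * π * j) * (((n : ℤ) * x + (t : ℕ) : ℤ) : ℂ) / n
      = I * ζ * x + ((j * x : ℤ) : ℂ) * (2 * π * I) + I * (ζ + 2 * π * j) * t / n by
        push_cast; field_simp,
    Complex.exp_add, Complex.exp_add, Complex.exp_int_mul_two_pi_mul_I, mul_one]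

/-- the phase at a fine point splits into the block phase and the offset phase:
`e^{i(p′+2πk)·z/n} = e^{ip′·x⁰} Π_ν e^{i(p′_ν+2πk_ν)τ_ν/n}`, `z = n x⁰ + τ`. [folklore] -/
theorem PhZ_finePt (n : ℕ) (hn : n ≠ 0) (k : Fin d → Fin n) (x : Fin d → ℤ) (j : Fin d → Fin n) (P : Fin d → ℂ) :
    PhZ n k (finePt n x j) P = cexp (I * phaseC P x) * ∏ ν, ef n (k ν : ℕ) (j ν : ℕ) (P ν) := by
  unfold PhZ finePt phaseC
  simp_rw [efZ_fine n _ hn]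
  rw [Finset.prod_mul_distrib, Finset.mul_sum, Complex.exp_sum]
  congr 1
  apply Finset.prod_congr rfl
  intro ν _
  ring_nf

/-- `Gfull(n x⁰ + τ; p′) = e^{ip′·x⁰} G(τ; p′)`: the full multiplier is the block-offset multiplier of `B4StripSums`
times the block phase. [cite: Balaban1983RegularityDecay, (2.48) p.585] -/
theorem Gfull_finePt (n : ℕ) [NeZero n] (a m2 : ℝ) (x : Fin d → ℤ) (j : Fin d → Fin n) (P : Fin d → ℂ) :
    Gfull n a m2 (finePt n x j) P = cexp (I * phaseC P x) * G n a m2 j P := by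
  unfold Gfull G term F V
  rw [Finset.mul_sum]
  apply Finset.sum_congr rfl
  intro k _
  rw [PhZ_finePt n (NeZero.ne n), mul_assoc (cexp _), ← Finset.prod_mul_distrib]
  ring

/-! ### §3 The symbol identity: `(−Δ^ξ + m² + aQ^*Q)` applied to `z ↦ Gfull(z; p′)` returns the pure block phase -/

/-- one coordinate step of the phase: `t ↦ t + 1`. [folklore] -/
theorem efZ_succ (n j : ℕ) (s : ℤ) (ζ : ℂ) :
    efZ n j (s + 1) ζ = efZ n j s ζ * cexp (I * ((ζ + 2 * π * j) / n)) := by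
  unfold efZ
  rw [← Complex.exp_add]
  congr 1
  push_cast; ring

/-- one coordinate step of the phase: `t ↦ t − 1`. [folklore] -/
theorem efZ_pred (n j : ℕ) (s : ℤ) (ζ : ℂ) :
    efZ n j (s - 1) ζ = efZ n j s ζ * cexp (-(I * ((ζ + 2 * π * j) / n))) := by
  unfold efZ
  rw [← Complex.exp_add]
  congr 1
  push_cast; ring

/-- nearest-neighbour step of the full phase, forward. [folklore] -/
theorem PhZ_add_e (n : ℕ) (k : Fin d → Fin n) (z : Fin d → ℤ) (μ : Fin d) (P : Fin d → ℂ) :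
    PhZ n k (z + e μ) P = PhZ n k z P * cexp (I * ((P μ + 2 * π * (k μ : ℕ)) / n)) := by
  unfold PhZ
  rw [← Finset.mul_prod_erase Finset.univ _ (Finset.mem_univ μ),
    ← Finset.mul_prod_erase Finset.univ (fun ν => efZ n (k ν) (z ν) (P ν)) (Finset.mem_univ μ)]
  have h1 : ∀ ν ∈ Finset.univ.erase μ, efZ n (k ν) ((z + e μ) ν) (P ν) = efZ n (k ν) (z ν) (P ν) := by
    intro ν hν
    rw [Finset.mem_erase] at hν
    simp [e, hν.1]
  rw [Finset.prod_congr rfl h1]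
  simp only [e, Pi.add_apply, Pi.single_eq_same]
  rw [efZ_succ]
  ring

/-- nearest-neighbour step of the full phase, backward. [folklore] -/
theorem PhZ_sub_e (n : ℕ) (k : Fin d → Fin n) (z : Fin d → ℤ) (μ : Fin d) (P : Fin d → ℂ) :
    PhZ n k (z - e μ) P = PhZ n k z P * cexp (-(I * ((P μ + 2 * π * (k μ : ℕ)) / n))) := by
  unfold PhZ
  rw [← Finset.mul_prod_erase Finset.univ _ (Finset.mem_univ μ),
    ← Finset.mul_prod_erase Finset.univ (fun ν => efZ n (k ν) (z ν) (P ν)) (Finset.mem_univ μ)]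
  have h1 : ∀ ν ∈ Finset.univ.erase μ, efZ n (k ν) ((z - e μ) ν) (P ν) = efZ n (k ν) (z ν) (P ν) := by
    intro ν hν
    rw [Finset.mem_erase] at hν
    simp [e, hν.1]
  rw [Finset.prod_congr rfl h1]
  simp only [e, Pi.sub_apply, Pi.single_eq_same]
  rw [efZ_pred]
  ring

/-- `(−Δ^ξ + m²)` ON THE PHASE: `n² Σ_μ [2 − e^{i(p′+l)_μ/n} − e^{−i(p′+l)_μ/n}] + m² = Δ^ξ(p′+l) + m²`, i.e. the plane wave
`z ↦ e^{i(p′+l)·z/n}` is an eigenfunction of `−Δ^ξ + m²` with eigenvalue `(Δ^ξ + m²)(p′ + l)` ((2.45): `Δ^ξ(p′) = Σ_μ |(e^{iξp′_μ} − 1)/ξ|²`).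
[cite: Balaban1983RegularityDecay, (2.45) p.584] -/
theorem lap_PhZ (n : ℕ) (m2 : ℝ) (k : Fin d → Fin n) (z : Fin d → ℤ) (P : Fin d → ℂ) :
    (n : ℂ) ^ 2 * (∑ μ, (2 * PhZ n k z P - PhZ n k (z + e μ) P - PhZ n k (z - e μ) P)) + m2 * PhZ n k z P
      = PhZ n k z P * DeltaXi n m2 (shift n k P) := by
  simp_rw [PhZ_add_e, PhZ_sub_e]
  have h : ∀ μ : Fin d, 2 * PhZ n k z P - PhZ n k z P * cexp (I * ((P μ + 2 * π * (k μ : ℕ)) / n))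
      - PhZ n k z P * cexp (-(I * ((P μ + 2 * π * (k μ : ℕ)) / n)))
        = PhZ n k z P * S1 ((P μ + 2 * π * (k μ : ℕ)) / n) := by
    intro μ; rw [← two_sub_exp]; ring
  simp_rw [h]
  rw [← Finset.mul_sum]
  unfold DeltaXi shift
  simp_rw [Sxi_eq_sq_mul_S1]
  rw [← Finset.mul_sum]
  ring

/-- the regrouped ratio undoes the fibre shift of the symbol: `R_k(p′) (Δ^ξ+m²)(p′+2πk) = (Δ^ξ+m²)(p′)` on the fat region
(every `k`; for `k ≠ 0` the shifted symbol does not vanish there). [folklore] -/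
theorem R_mul_DeltaXi_shift (n : ℕ) [NeZero n] (m2 : ℝ) (hm : 0 ≤ m2) {P : Fin d → ℂ} (hP : P ∈ Fat d 0)
    (k : Fin d → Fin n) : R n m2 k P * DeltaXi n m2 (shift n k P) = DeltaXi n m2 P := by
  unfold R
  split_ifs with hk
  · rw [hk, shift_zero, one_mul]
  · exact div_mul_cancel₀ _ (DeltaXi_shift_ne_zero n m2 hm (r := 0) (by norm_num) (by norm_num) hP k hk)

/-- the regrouped denominator as the `R`-weighted fibre sum: `E = (Δ^ξ+m²) + a Σ_k U_k R_k`. [folklore] -/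
theorem E_eq_sum_R (n : ℕ) [NeZero n] (a m2 : ℝ) (P : Fin d → ℂ) :
    E n a m2 P = DeltaXi n m2 P + a * ∑ k : Fin d → Fin n, U n k P * R n m2 k P := by
  unfold E R
  rw [← Finset.add_sum_erase Finset.univ _ (Finset.mem_univ (fun _ => (0 : Fin n))), if_pos rfl, mul_one]
  have h : ∀ k ∈ Finset.univ.erase (fun _ => (0 : Fin n)),
      U n k P * (if k = (fun _ => (0 : Fin n)) then 1 else DeltaXi n m2 P / DeltaXi n m2 (shift n k P))
        = U n k P * (DeltaXi n m2 P / DeltaXi n m2 (shift n k P)) := by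
    intro k hk
    rw [if_neg (Finset.mem_erase.mp hk).1]
  rw [Finset.sum_congr rfl h]
  ring

/-- real momenta of the Brillouin zone lie in the fat region of radius `0`. [folklore] -/
theorem ofRealVec_mem_Fat (p : Fin d → ℝ) (hp : p ∈ BZ d) : ofRealVec p ∈ Fat d 0 :=
  strip_subset_fat le_rfl le_rfl (ofRealVec_mem_Strip le_rfl hp)

/-- on the Brillouin zone the regrouped denominator does not vanish (`a > 0`). [folklore] -/
theorem E_ne_zero_BZ (n : ℕ) [NeZero n] (hn : 1 ≤ n) (a m2 : ℝ) (ha : 0 < a) (hm : 0 ≤ m2) (p : Fin d → ℝ)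
    (hp : p ∈ BZ d) : E n a m2 (ofRealVec p) ≠ 0 := by
  have hs : ∀ μ, |p μ| ≤ Real.pi := fun μ => abs_le.mpr ⟨hp.1 μ, hp.2 μ⟩
  have h := E_re_ge n hn a m2 ha.le hm p hs
  have hpos : 0 < a * (4 / Real.pi ^ 2) ^ d := by positivity
  intro h0
  rw [h0, norm_zero] at h
  linarith

/-- **`Q_jQ_j^* = 1` (fibre sum of the phases)**: `Σ_k e^{i(p′+2πk)·z/n} V(k; p′) = e^{ip′·⌊z/n⌋}` for every complex `p′`
(the `l`-sum of `e^{i(p′+l)x} u_j(p′+l)` collapses to the block phase). [cite: Balaban1983RegularityDecay, (2.44)–(2.46) p.584] -/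
theorem sum_PhZ_V (n : ℕ) [NeZero n] (z : Fin d → ℤ) (P : Fin d → ℂ) :
    ∑ k : Fin d → Fin n, PhZ n k z P * V n k P = cexp (I * phaseC P (coarse n z)) := by
  have hn : n ≠ 0 := NeZero.ne n
  conv_lhs => rw [← finePt_coarse_offset n z]
  simp_rw [PhZ_finePt n hn, V, mul_assoc, ← Finset.prod_mul_distrib]
  rw [← Finset.mul_sum]
  have h := Finset.prod_univ_sum (fun _ : Fin d => (Finset.univ : Finset (Fin n)))
    (fun ν i => ef n (i : ℕ) ((offset n z ν : ℕ)) (P ν) * v n (i : ℕ) (P ν))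
  rw [Fintype.piFinset_univ] at h
  rw [← h]
  have h1 : ∀ ν : Fin d, ∑ i : Fin n, ef n (i : ℕ) ((offset n z ν : ℕ)) (P ν) * v n (i : ℕ) (P ν) = 1 := by
    intro ν
    rw [Fin.sum_univ_eq_sum_range (fun i => ef n i ((offset n z ν : ℕ)) (P ν) * v n i (P ν)) n]
    exact sum_ef_mul_v n _ hn (offset n z ν).isLt (P ν)
  simp_rw [h1]
  simp

/-- **`Q_j` OF THE PHASE TIMES `u`, ON THE REAL ZONE**: the block average of `z ↦ e^{i(p′+2πk)·z/n} V(k;p′)` over the block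
`B(x⁰)` is `e^{ip′·x⁰} |u_j(p′+2πk)|²` (`= e^{ip′·x⁰} U_k(p′)`), `p′ ∈ [−π,π]^d`. [cite: Balaban1983RegularityDecay, (2.45)–(2.46) p.584] -/
theorem blockAvg_PhZ_V (n : ℕ) [NeZero n] (hn : 1 ≤ n) (k : Fin d → Fin n) (x : Fin d → ℤ) (p : Fin d → ℝ)
    (hp : p ∈ BZ d) :
    ((n : ℂ) ^ d)⁻¹ * ∑ j : Fin d → Fin n, PhZ n k (finePt n x j) (ofRealVec p) * V n k (ofRealVec p)
      = cexp (I * phaseC (ofRealVec p) x) * U n k (ofRealVec p) := by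
  have hn0 : n ≠ 0 := by omega
  simp_rw [PhZ_finePt n hn0, V, mul_assoc, ← Finset.prod_mul_distrib]
  rw [← Finset.mul_sum]
  have h := Finset.prod_univ_sum (fun _ : Fin d => (Finset.univ : Finset (Fin n)))
    (fun ν i => ef n (k ν : ℕ) (i : ℕ) (ofRealVec p ν) * v n (k ν : ℕ) (ofRealVec p ν))
  rw [Fintype.piFinset_univ] at h
  rw [← h]
  have h1 : ∀ ν : Fin d, ∑ i : Fin n, ef n (k ν : ℕ) (i : ℕ) (ofRealVec p ν) * v n (k ν : ℕ) (ofRealVec p ν)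
      = (n : ℂ) * (vb n (k ν) (p ν) * v n (k ν) (p ν)) := by
    intro ν
    rw [Fin.sum_univ_eq_sum_range (fun i => ef n (k ν : ℕ) i (ofRealVec p ν) * v n (k ν : ℕ) (ofRealVec p ν)) n,
      ← Finset.sum_mul]
    unfold vb ofRealVec
    field_simp [Nat.cast_ne_zero.mpr hn0]
  simp_rw [h1]
  rw [Finset.prod_mul_distrib, Finset.prod_const, Finset.card_univ, Fintype.card_fin, ← mul_assoc, ← mul_assoc,
    mul_comm (((n : ℂ) ^ d)⁻¹), mul_assoc (cexp _), inv_mul_cancel₀ (pow_ne_zero _ (Nat.cast_ne_zero.mpr hn0)),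
    mul_one]
  congr 1
  unfold U
  apply Finset.prod_congr rfl
  intro ν _
  exact vb_mul_v_eq_uFactor n (k ν) hn (k ν).isLt (p ν) (abs_le.mpr ⟨hp.1 ν, hp.2 ν⟩)


/-! ### §4 The operator `−Δ^ξ + m² + aQ^*Q` of (2.44) on the infinite fine lattice and its symbol identity -/

/-- `(−Δ^ξφ)(z) = ξ^{−2} Σ_μ [2φ(z) − φ(z+e_μ) − φ(z−e_μ)]` on `ℓ(ℤ^d)` (`ξ = 1/n`; the quadratic form (1.3) with `A = 0`,
free boundary conditions on the whole lattice). [cite: Balaban1983RegularityDecay, (1.3) p.572, (2.44)–(2.45) p.584] -/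
def negLap (n : ℕ) (φ : (Fin d → ℤ) → ℂ) (z : Fin d → ℤ) : ℂ :=
  (n : ℂ) ^ 2 * ∑ μ, (2 * φ z - φ (z + e μ) - φ (z - e μ))

/-- `(Q^*Qφ)(z) = ξ^{d} Σ_{z′ ∈ B(z)} φ(z′)`: the block-averaging projection `P = Q^*Q` of (1.4)–(1.5) (`A = 0`), `B(z)` the
block of `n^d` fine points containing `z`. [cite: Balaban1983RegularityDecay, (1.4)–(1.5) p.572] -/
def blockAvg (n : ℕ) (φ : (Fin d → ℤ) → ℂ) (z : Fin d → ℤ) : ℂ :=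
  ((n : ℂ) ^ d)⁻¹ * ∑ j : Fin d → Fin n, φ (finePt n (coarse n z) j)

/-- THE OPERATOR OF THE BASIC EQUATION (2.44): `D = −Δ^ξ + m² + a Q^*Q` (`= G_j⁻¹` of (1.6) with `A = 0`, `Ω = ξℤ^d`).
[cite: Balaban1983RegularityDecay, (1.6) p.572, (2.44) p.584] -/
def opD (n : ℕ) (a m2 : ℝ) (φ : (Fin d → ℤ) → ℂ) (z : Fin d → ℤ) : ℂ :=
  negLap n φ z + m2 * φ z + a * blockAvg n φ z

/-- **THE SYMBOL IDENTITY** ((2.45) solved by (2.46)–(2.47), checked): for `p′ ∈ [−π,π]^d`,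
`D_z Gfull(z; p′) = e^{ip′·⌊z/n⌋}` — the `−Δ^ξ + m²` part gives `(Δ^ξ+m²)(p′)/E(p′) · e^{ip′·x⁰}` (eigenvalue times `R_k`,
then `Q_jQ_j^* = 1`), the `aQ^*Q` part gives `a Σ_k U_k R_k/E(p′) · e^{ip′·x⁰}`, and `(Δ^ξ+m²) + aΣ_k U_k R_k = E`.
[cite: Balaban1983RegularityDecay, (2.44)–(2.47) p.584–585] -/
theorem opD_Gfull (n : ℕ) [NeZero n] (hn : 1 ≤ n) (a m2 : ℝ) (ha : 0 < a) (hm : 0 ≤ m2) (z : Fin d → ℤ)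
    (p : Fin d → ℝ) (hp : p ∈ BZ d) :
    opD n a m2 (fun z' => Gfull n a m2 z' (ofRealVec p)) z = cexp (I * phaseC (ofRealVec p) (coarse n z)) := by
  have hPF : ofRealVec p ∈ Fat d 0 := ofRealVec_mem_Fat p hp
  have hE : E n a m2 (ofRealVec p) ≠ 0 := E_ne_zero_BZ n hn a m2 ha hm p hp
  -- the `−Δ^ξ + m²` part
  have h1 : negLap n (fun z' => Gfull n a m2 z' (ofRealVec p)) z + m2 * Gfull n a m2 z (ofRealVec p)
      = DeltaXi n m2 (ofRealVec p) / E n a m2 (ofRealVec p) * cexp (I * phaseC (ofRealVec p) (coarse n z)) := by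
    simp only [negLap, Gfull]
    have h0 : ∀ μ : Fin d,
        2 * (∑ k : Fin d → Fin n, PhZ n k z (ofRealVec p) * V n k (ofRealVec p) * R n m2 k (ofRealVec p)
            / E n a m2 (ofRealVec p))
          - (∑ k : Fin d → Fin n, PhZ n k (z + e μ) (ofRealVec p) * V n k (ofRealVec p) * R n m2 k (ofRealVec p)
            / E n a m2 (ofRealVec p))
          - (∑ k : Fin d → Fin n, PhZ n k (z - e μ) (ofRealVec p) * V n k (ofRealVec p) * R n m2 k (ofRealVec p)
            / E n a m2 (ofRealVec p))
          = ∑ k : Fin d → Fin n, (2 * PhZ n k z (ofRealVec p) - PhZ n k (z + e μ) (ofRealVec p)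
              - PhZ n k (z - e μ) (ofRealVec p))
              * (V n k (ofRealVec p) * R n m2 k (ofRealVec p) / E n a m2 (ofRealVec p)) := by
      intro μ
      rw [Finset.mul_sum, ← Finset.sum_sub_distrib, ← Finset.sum_sub_distrib]
      apply Finset.sum_congr rfl
      intro k _
      ring
    simp_rw [h0]
    rw [Finset.sum_comm]
    have h2 : ∀ k : Fin d → Fin n,
        (n : ℂ) ^ 2 * ∑ μ : Fin d, (2 * PhZ n k z (ofRealVec p) - PhZ n k (z + e μ) (ofRealVec p)
              - PhZ n k (z - e μ) (ofRealVec p))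
              * (V n k (ofRealVec p) * R n m2 k (ofRealVec p) / E n a m2 (ofRealVec p))
          + m2 * (PhZ n k z (ofRealVec p) * V n k (ofRealVec p) * R n m2 k (ofRealVec p) / E n a m2 (ofRealVec p))
        = PhZ n k z (ofRealVec p) * V n k (ofRealVec p)
            * (DeltaXi n m2 (ofRealVec p) / E n a m2 (ofRealVec p)) := by
      intro k
      have hl := lap_PhZ n m2 k z (ofRealVec p)
      have hr := R_mul_DeltaXi_shift n m2 hm hPF k
      rw [← Finset.sum_mul, ← mul_assoc,
        show (n : ℂ) ^ 2 * ∑ μ : Fin d, (2 * PhZ n k z (ofRealVec p) - PhZ n k (z + e μ) (ofRealVec p)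
              - PhZ n k (z - e μ) (ofRealVec p))
            = PhZ n k z (ofRealVec p) * DeltaXi n m2 (shift n k (ofRealVec p)) - m2 * PhZ n k z (ofRealVec p) by
          rw [← hl]; ring,
        ← hr]
      ring
    have h3 : (n : ℂ) ^ 2 * ∑ k : Fin d → Fin n, ∑ μ : Fin d, (2 * PhZ n k z (ofRealVec p)
              - PhZ n k (z + e μ) (ofRealVec p) - PhZ n k (z - e μ) (ofRealVec p))
              * (V n k (ofRealVec p) * R n m2 k (ofRealVec p) / E n a m2 (ofRealVec p))
          + m2 * ∑ k : Fin d → Fin n, PhZ n k z (ofRealVec p) * V n k (ofRealVec p) * R n m2 k (ofRealVec p)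
              / E n a m2 (ofRealVec p)
        = ∑ k : Fin d → Fin n, ((n : ℂ) ^ 2 * ∑ μ : Fin d, (2 * PhZ n k z (ofRealVec p)
              - PhZ n k (z + e μ) (ofRealVec p) - PhZ n k (z - e μ) (ofRealVec p))
              * (V n k (ofRealVec p) * R n m2 k (ofRealVec p) / E n a m2 (ofRealVec p))
          + m2 * (PhZ n k z (ofRealVec p) * V n k (ofRealVec p) * R n m2 k (ofRealVec p)
              / E n a m2 (ofRealVec p))) := by
      rw [Finset.sum_add_distrib, ← Finset.mul_sum, ← Finset.mul_sum]
    rw [h3, Finset.sum_congr rfl (fun k _ => h2 k), ← Finset.sum_mul, sum_PhZ_V]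
    ring
  -- the `aQ^*Q` part
  have h4 : blockAvg n (fun z' => Gfull n a m2 z' (ofRealVec p)) z
      = (∑ k : Fin d → Fin n, U n k (ofRealVec p) * R n m2 k (ofRealVec p)) / E n a m2 (ofRealVec p)
          * cexp (I * phaseC (ofRealVec p) (coarse n z)) := by
    simp only [blockAvg, Gfull]
    rw [Finset.sum_comm]
    have h5 : ∀ k : Fin d → Fin n,
        ∑ j : Fin d → Fin n, PhZ n k (finePt n (coarse n z) j) (ofRealVec p) * V n k (ofRealVec p)
            * R n m2 k (ofRealVec p) / E n a m2 (ofRealVec p)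
          = (∑ j : Fin d → Fin n, PhZ n k (finePt n (coarse n z) j) (ofRealVec p) * V n k (ofRealVec p))
              * (R n m2 k (ofRealVec p) / E n a m2 (ofRealVec p)) := by
      intro k
      rw [Finset.sum_mul]
      apply Finset.sum_congr rfl
      intro j _
      ring
    rw [Finset.sum_congr rfl (fun k _ => h5 k), Finset.mul_sum]
    have h6 : ∀ k : Fin d → Fin n,
        ((n : ℂ) ^ d)⁻¹ * ((∑ j : Fin d → Fin n, PhZ n k (finePt n (coarse n z) j) (ofRealVec p) * V n k (ofRealVec p))
            * (R n m2 k (ofRealVec p) / E n a m2 (ofRealVec p)))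
          = cexp (I * phaseC (ofRealVec p) (coarse n z))
              * (U n k (ofRealVec p) * R n m2 k (ofRealVec p) / E n a m2 (ofRealVec p)) := by
      intro k
      rw [← mul_assoc, blockAvg_PhZ_V n hn k (coarse n z) p hp]
      ring
    rw [Finset.sum_congr rfl (fun k _ => h6 k), ← Finset.mul_sum, ← Finset.sum_div]
    ring
  simp only [opD]
  rw [h1, h4]
  calc DeltaXi n m2 (ofRealVec p) / E n a m2 (ofRealVec p) * cexp (I * phaseC (ofRealVec p) (coarse n z))
        + a * ((∑ k : Fin d → Fin n, U n k (ofRealVec p) * R n m2 k (ofRealVec p)) / E n a m2 (ofRealVec p)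
          * cexp (I * phaseC (ofRealVec p) (coarse n z)))
      = cexp (I * phaseC (ofRealVec p) (coarse n z))
          * ((DeltaXi n m2 (ofRealVec p) + a * ∑ k : Fin d → Fin n, U n k (ofRealVec p) * R n m2 k (ofRealVec p))
            / E n a m2 (ofRealVec p)) := by ring
    _ = cexp (I * phaseC (ofRealVec p) (coarse n z)) := by
      rw [← E_eq_sum_R, div_self hE, mul_one]

/-- the finite stencil of `D`: index set (centre; forward neighbours; backward neighbours; the block). [folklore] -/
abbrev Idx (d n : ℕ) := Unit ⊕ (Fin d ⊕ (Fin d ⊕ (Fin d → Fin n)))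

/-- stencil coefficients of `D`. [folklore] -/
def stc (d n : ℕ) (a m2 : ℝ) : Idx d n → ℂ
  | Sum.inl _ => 2 * (d : ℂ) * (n : ℂ) ^ 2 + m2
  | Sum.inr (Sum.inl _) => -(n : ℂ) ^ 2
  | Sum.inr (Sum.inr (Sum.inl _)) => -(n : ℂ) ^ 2
  | Sum.inr (Sum.inr (Sum.inr _)) => a * ((n : ℂ) ^ d)⁻¹

/-- stencil points of `D` at `z`. [folklore] -/
def stp (n : ℕ) (z : Fin d → ℤ) : Idx d n → (Fin d → ℤ)
  | Sum.inl _ => z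
  | Sum.inr (Sum.inl μ) => z + e μ
  | Sum.inr (Sum.inr (Sum.inl μ)) => z - e μ
  | Sum.inr (Sum.inr (Sum.inr j)) => finePt n (coarse n z) j

/-- `D` is a finite stencil: `(Dφ)(z) = Σ_i c_i φ(z_i)`. [folklore] -/
theorem opD_eq_stencil (n : ℕ) (a m2 : ℝ) (φ : (Fin d → ℤ) → ℂ) (z : Fin d → ℤ) :
    opD n a m2 φ z = ∑ i : Idx d n, stc d n a m2 i * φ (stp n z i) := by
  rw [Fintype.sum_sum_type, Fintype.sum_sum_type, Fintype.sum_sum_type, Fintype.sum_unique]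
  simp only [stc, stp, opD, negLap, blockAvg, Finset.sum_sub_distrib, Finset.sum_const, Finset.card_univ,
    Fintype.card_fin, nsmul_eq_mul, ← Finset.mul_sum]
  ring

/-! ### §5 Lattice-kernel calculus: phases translate, zone-continuous multipliers superpose, `∫e^{ip·x}dp = (2π)^dδ_{x,0}` -/

/-- a phase factor `e^{ip′·s}` in the multiplier translates the kernel by `s`. [folklore] -/
theorem latticeKernel_phase_mul (Gm : (Fin d → ℂ) → ℂ) (x s : Fin d → ℤ) :
    latticeKernel (fun P => cexp (I * phaseC P s) * Gm P) x = latticeKernel Gm (x + s) := by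
  unfold latticeKernel fourierBox integrand
  congr 1
  refine integral_congr_ae (Filter.Eventually.of_forall fun q => ?_)
  show cexp (I * phaseC (ofRealVec q) s) * Gm (ofRealVec q) * cexp (I * phase q x)
    = Gm (ofRealVec q) * cexp (I * phase q (x + s))
  rw [phaseC_ofRealVec, phase_add, mul_add, Complex.exp_add]
  ring

/-- multipliers that agree on the real zone have the same kernel. [folklore] -/
theorem latticeKernel_congr {G1 G2 : (Fin d → ℂ) → ℂ} (h : ∀ p ∈ BZ d, G1 (ofRealVec p) = G2 (ofRealVec p))
    (x : Fin d → ℤ) : latticeKernel G1 x = latticeKernel G2 x := by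
  unfold latticeKernel fourierBox
  congr 1
  apply MeasureTheory.setIntegral_congr_fun measurableSet_Icc
  intro p hp
  show G1 (ofRealVec p) * cexp (I * phase p x) = G2 (ofRealVec p) * cexp (I * phase p x)
  rw [h p hp]

/-- finite superposition: the kernel of `Σ_i c_i G_i` is `Σ_i c_i K_i` for zone-integrable multipliers. [folklore] -/
theorem latticeKernel_sum_mul {ι : Type*} (s : Finset ι) (c : ι → ℂ) (Gm : ι → (Fin d → ℂ) → ℂ) (x : Fin d → ℤ)
    (hint : ∀ i ∈ s, IntegrableOn (integrand (Gm i) x) (BZ d)) :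
    latticeKernel (fun P => ∑ i ∈ s, c i * Gm i P) x = ∑ i ∈ s, c i * latticeKernel (Gm i) x := by
  unfold latticeKernel fourierBox
  have h1 : integrand (fun P => ∑ i ∈ s, c i * Gm i P) x = fun p => ∑ i ∈ s, c i * integrand (Gm i) x p := by
    funext p
    unfold integrand
    rw [Finset.sum_mul]
    apply Finset.sum_congr rfl
    intro i _
    ring
  rw [h1, MeasureTheory.integral_finsetSum s (fun i hi => (hint i hi).const_mul (c i)), Finset.smul_sum]
  apply Finset.sum_congr rfl
  intro i _
  rw [MeasureTheory.integral_const_mul, mul_smul_comm]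

/-- a multiplier holomorphic (hence continuous) at the real zone has an integrable integrand. [folklore] -/
theorem integrableOn_of_differentiableAt {f : (Fin d → ℂ) → ℂ} (h : ∀ p ∈ BZ d, DifferentiableAt ℂ f (ofRealVec p))
    (x : Fin d → ℤ) : IntegrableOn (integrand f x) (BZ d) := by
  have hc : ContinuousOn (integrand f x) (BZ d) := by
    refine ContinuousOn.mul ?_ ?_
    · intro p hp
      exact ((h p hp).continuousAt.comp continuous_ofRealVec.continuousAt).continuousWithinAt
    · refine Continuous.continuousOn ?_
      unfold phase
      fun_prop
  unfold BZ
  exact hc.integrableOn_compact isCompact_Icc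

/-- one coordinate: `∫_{−π}^{π} e^{itm} dt = 2π δ_{m,0}`, `m ∈ ℤ`. [folklore] -/
theorem integral_cexp_int (m : ℤ) :
    ∫ t in Set.Icc (-π) π, cexp (I * (t : ℂ) * (m : ℂ)) = if m = 0 then (2 * π : ℂ) else 0 := by
  rw [MeasureTheory.integral_Icc_eq_integral_Ioc, ← intervalIntegral.integral_of_le (by linarith [Real.pi_pos])]
  split_ifs with hm
  · subst hm
    simp only [Int.cast_zero, mul_zero, Complex.exp_zero, intervalIntegral.integral_const, sub_neg_eq_add,
      Complex.real_smul, mul_one]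
    push_cast
    ring
  · have hc : (I * (m : ℂ)) ≠ 0 := mul_ne_zero Complex.I_ne_zero (by exact_mod_cast hm)
    have h1 : ∀ t : ℝ, cexp (I * (t : ℂ) * (m : ℂ)) = cexp ((I * m) * (t : ℂ)) := fun t => by ring_nf
    simp_rw [h1]
    rw [integral_exp_mul_complex hc]
    have h2 : cexp (I * m * ((π : ℝ) : ℂ)) = cexp (I * m * ((-π : ℝ) : ℂ)) := by
      rw [show I * m * ((π : ℝ) : ℂ) = I * m * ((-π : ℝ) : ℂ) + (m : ℂ) * (2 * π * I) by push_cast; ring,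
        Complex.exp_add, Complex.exp_int_mul_two_pi_mul_I, mul_one]
    rw [h2, sub_self, zero_div]

/-- `∫_{[−π,π]^d} e^{ip·x} dp = (2π)^d δ_{x,0}`, `x ∈ ℤ^d` (Fubini over the cube). [folklore] -/
theorem fourierBox_one (x : Fin d → ℤ) :
    fourierBox (fun _ => (1 : ℂ)) x = if x = 0 then ((2 * π : ℂ)) ^ d else 0 := by
  unfold fourierBox integrand
  simp_rw [one_mul]
  have hset : BZ d = Set.pi Set.univ (fun _ : Fin d => Set.Icc (-π) π) := (Set.pi_univ_Icc _ _).symm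
  rw [hset, MeasureTheory.volume_pi, MeasureTheory.Measure.restrict_pi_pi]
  have hphase : ∀ q : Fin d → ℝ, cexp (I * phase q x) = ∏ μ, cexp (I * (q μ : ℂ) * (x μ : ℂ)) := by
    intro q
    unfold phase
    rw [Finset.mul_sum, Complex.exp_sum]
    apply Finset.prod_congr rfl
    intro μ _
    ring_nf
  simp_rw [hphase]
  rw [MeasureTheory.integral_fintype_prod_eq_prod (𝕜 := ℂ) (fun μ (t : ℝ) => cexp (I * (t : ℂ) * (x μ : ℂ)))]
  simp_rw [integral_cexp_int]
  split_ifs with hx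
  · subst hx
    simp
  · obtain ⟨μ, hμ⟩ : ∃ μ, x μ ≠ 0 := by
      by_contra h
      push Not at h
      exact hx (funext h)
    apply Finset.prod_eq_zero (Finset.mem_univ μ)
    rw [if_neg hμ]

/-- `(2π)^{-d} ∫_{[−π,π]^d} e^{ip·x} dp = δ_{x,0}`: the kernel of the identity. [folklore] -/
theorem latticeKernel_one (x : Fin d → ℤ) : latticeKernel (fun _ => (1 : ℂ)) x = if x = 0 then 1 else 0 := by
  unfold latticeKernel
  rw [fourierBox_one, Complex.real_smul]
  split_ifs with hx
  · push_cast
    exact inv_mul_cancel₀ (pow_ne_zero _ (mul_ne_zero two_ne_zero (by exact_mod_cast Real.pi_ne_zero)))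
  · rw [mul_zero]

/-- the kernel of a pure phase `e^{ip′·s}` is `δ_{x+s,0}`. [folklore] -/
theorem latticeKernel_phase (s x : Fin d → ℤ) :
    latticeKernel (fun P => cexp (I * phaseC P s)) x = if x + s = 0 then 1 else 0 := by
  have h : (fun P : Fin d → ℂ => cexp (I * phaseC P s)) = fun P => cexp (I * phaseC P s) * (fun _ => (1 : ℂ)) P := by
    funext P; simp
  rw [h, latticeKernel_phase_mul, latticeKernel_one]

/-- `D` commutes with the passage multiplier ↦ kernel (finite stencil, zone-integrable multipliers). [folklore] -/
theorem opD_latticeKernel (n : ℕ) (a m2 : ℝ) (Gm : (Fin d → ℤ) → (Fin d → ℂ) → ℂ) (x : Fin d → ℤ)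
    (hint : ∀ z', IntegrableOn (integrand (Gm z') x) (BZ d)) (z : Fin d → ℤ) :
    opD n a m2 (fun z' => latticeKernel (Gm z') x) z = latticeKernel (fun P => opD n a m2 (fun z' => Gm z' P) z) x := by
  simp only [opD_eq_stencil]
  exact (latticeKernel_sum_mul Finset.univ (stc d n a m2) (fun i => Gm (stp n z i)) x (fun i _ => hint _)).symm

/-! ### §6 The kernel of (2.48) and the basic equation (2.44) -/

/-- THE POSITION-SPACE KERNEL OF (2.48) ON THE INFINITE FINE LATTICE: `K(z, y) = (G_jQ_j^*)(ξz, y)`,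
`z ∈ ℤ^d` (fine point, `ξ`-units), `y ∈ ℤ^d` (unit-lattice point) — by DEFINITION the lattice kernel of the block-offset
multiplier `G(z mod n; ·)` of `B4StripSums` read at `⌊z/n⌋ − y` (the object whose decay is `B4StripSums.kernel248_decay`).
[cite: Balaban1983RegularityDecay, (2.48) p.585] -/
def K (n : ℕ) [NeZero n] (a m2 : ℝ) (z y : Fin d → ℤ) : ℂ := latticeKernel (G n a m2 (offset n z)) (coarse n z - y)

/-- `K(z, y) = (2π)^{-d} ∫ Gfull(z; p′) e^{−ip′·y} dp′` — literally (2.48) (`e^{i(p′+l)·(x−y)} = e^{i(p′+l)·x} e^{−ip′·y}` for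
`y ∈ ℤ^d`). [cite: Balaban1983RegularityDecay, (2.48) p.585] -/
theorem K_eq (n : ℕ) [NeZero n] (a m2 : ℝ) (z y : Fin d → ℤ) : K n a m2 z y = latticeKernel (Gfull n a m2 z) (-y) := by
  have hz : Gfull n a m2 z = fun P => cexp (I * phaseC P (coarse n z)) * G n a m2 (offset n z) P := by
    funext P
    rw [← Gfull_finePt, finePt_coarse_offset]
  rw [hz, latticeKernel_phase_mul, K, neg_add_eq_sub]

/-- the full multiplier is holomorphic at every point of the real zone (`a > 0`, `m² ≥ 0`). [folklore] -/
theorem differentiableAt_Gfull (n : ℕ) [NeZero n] (hn : 1 ≤ n) (a m2 : ℝ) (ha : 0 < a) (hm : 0 ≤ m2)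
    (z : Fin d → ℤ) (p : Fin d → ℝ) (hp : p ∈ BZ d) : DifferentiableAt ℂ (Gfull n a m2 z) (ofRealVec p) := by
  have hPF : ofRealVec p ∈ Fat d 0 := ofRealVec_mem_Fat p hp
  have hE : E n a m2 (ofRealVec p) ≠ 0 := E_ne_zero_BZ n hn a m2 ha hm p hp
  show DifferentiableAt ℂ (fun P => ∑ k : Fin d → Fin n, PhZ n k z P * V n k P * R n m2 k P / E n a m2 P) _
  apply DifferentiableAt.fun_sum
  intro k _
  have hV : DifferentiableAt ℂ (V n k) (ofRealVec p) := by
    have : V n k = F n (fun _ => (0 : Fin n)) k := by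
      funext P; rw [F_zero]
    rw [this]
    exact differentiableAt_F n _ k _
  exact dAt_div (((differentiableAt_PhZ n k z _).mul hV).mul
    (differentiableAt_R n m2 hm (r := 0) (by norm_num) (by norm_num) hPF k))
    (differentiableAt_E n a m2 hm (r := 0) (by norm_num) (by norm_num) hPF) hE

/-- **B4 (2.44) FOR THE KERNEL (2.48) — `K = G_jQ_j^*` AS AN IDENTITY ON THE INFINITE FINE LATTICE.**
For every `n = L^j ≥ 1`, `a > 0`, `m² ≥ 0` and all `z, y ∈ ℤ^d`:
`(−Δ^ξ + m² + aQ^*Q)_z K(z, y) = 1_{B(y)}(z) = (Q_j^*δ_y)(z)`,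
i.e. `φ₀ = K(·, y)` solves the basic equation (2.44) `(−Δ^ξ + m_j² + a_jQ_j^*Q_j)φ₀ = f` with `f = Q_j^*δ_y` — the content of
p. 584 «Defining the propagator G_j, φ₀ = G_jf, we get (2.45) […] Solving this equation we obtain the following formula: (2.46)
[…]» and p. 585 «To calculate G_jQ_j^*, we take f = Q_j^*g in this formula, g is a function on the unit lattice, […] and we
get (2.47) […] From this we obtain finally the following formula for (G_jQ_j^*)(x,y), (2.48)» (here `g = δ_y`).
(Kernel convention: `(G_jQ_j^*g)(ξz) = Σ_y K(z,y) g(y)`; `D G_j = ξ^{-d}δ` on `ℓ²(ξ^d)` makes `D(G_jQ_j^*)(·,y) = Q_j^*δ_y`.)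
[cite: Balaban1983RegularityDecay, (2.44)–(2.47) p.584–585, (2.48) p.585] -/
theorem green244 (n : ℕ) [NeZero n] (hn : 1 ≤ n) (a m2 : ℝ) (ha : 0 < a) (hm : 0 ≤ m2) (z y : Fin d → ℤ) :
    opD n a m2 (fun z' => K n a m2 z' y) z = if coarse n z = y then 1 else 0 := by
  simp only [K_eq]
  rw [opD_latticeKernel n a m2 (fun z' P => Gfull n a m2 z' P) (-y)
    (fun z' => integrableOn_of_differentiableAt (fun p hp => differentiableAt_Gfull n hn a m2 ha hm z' p hp) (-y)) z]
  trans latticeKernel (fun P => cexp (I * phaseC P (coarse n z))) (-y)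
  · exact latticeKernel_congr (fun p hp => opD_Gfull n hn a m2 ha hm z p hp) (-y)
  · rw [latticeKernel_phase]
    by_cases h : coarse n z = y
    · rw [if_pos h, if_pos (by rw [h, neg_add_cancel])]
    · rw [if_neg h, if_neg (fun h' => h (neg_add_eq_zero.mp h').symm)]


/-- (2.35) FOR THE SAME OBJECT: the kernel `K(z, y)` decays exponentially in `|⌊z/n⌋ − y|_∞`, uniformly in `n = L^j`, the
offset, `a ∈ [a₋, a₊]` (`a₋ > 0`) and `m² ∈ [0, m²₊]` — `B4StripSums.kernel248_decay` read through the definition of `K`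
(dimension written `d + 1 ≥ 1`). Together with `green244`: the function that solves (2.44) with `f = Q_j^*δ_y` IS the one
whose decay was certified. [cite: Balaban1983RegularityDecay, Lemma 2.4 (2.35) p.582; (2.48) p.585] -/
theorem K_decay (d : ℕ) (aminus aplus m2plus : ℝ) (ha : 0 < aminus) :
    ∃ κ M : ℝ, 0 < κ ∧ 0 ≤ M ∧ ∀ (n : ℕ) [NeZero n] (a m2 : ℝ), aminus ≤ a → a ≤ aplus → 0 ≤ m2 →
      m2 ≤ m2plus → ∀ z y : Fin (d + 1) → ℤ, ‖K n a m2 z y‖ ≤ M * Real.exp (-(κ * supNorm (coarse n z - y))) := by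
  obtain ⟨κ, M, hκ, hM, h⟩ := kernel248_decay d aminus aplus m2plus ha
  exact ⟨κ, M, hκ, hM, fun n _ a m2 h1 h2 h3 h4 z y => h n a m2 h1 h2 h3 h4 (offset n z) (coarse n z - y)⟩

end

end Literature.MathematicalPhysics.QuantumFieldTheory.Balaban1983to89.B4Green244
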